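import Mathlib
import HarnessLib
import Summits.PneNP.PneNP.Theorems.CnfIdealGenLengthRankDefectRepresentationsExactification

/-!
# Crux `RankDefectRepresentations` (stmt-PneNP-18923), line `phantom-kernel`: stub N2 `stub_pairStability`

FIRST RUNG OF THE KILL PATH (lead prover, 2026-08-27).  The crux and the line's hard stub S1 are refuted
(`not_rankDefectRepresentations_of_polyStable`, p542939; `not_contradictoryPhantoms_of_polyStable`, p580392) if the
Boolean/commutator presentation is POLYNOMIALLY rank-stable.  Here: the case of TWO exact idempotents, with a LINEAR
modulus — `E, F` idempotent are within total rank `4 · rank [E, F]` of a commuting idempotent pair `(E, F')`.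
Construction: compress `F` to the commutant of `E`, `F_c = EFE + (1-E)F(1-E)` (`F - F_c = E[E,F] - [E,F]E`, rank
`≤ 2c`); the two compressions `A₁ = EFE`, `A₂ = (1-E)F(1-E)` have idempotency defects `A₁² - A₁ = -(E[E,F])(FE)`,
`A₂² - A₂ = ((1-E)F)([E,F]E)`... of rank `≤ c` each, and the cheap Fitting lemma in its STRUCTURED form
(`exists_idempotent_near_struct`: the idempotent `P = A π_{ker(A²-A)}` has `im P ⊆ im A` and `ker A ⊆ ker P`) turns
them into idempotents `P₁, P₂` with `E P₁ = P₁ = P₁ E`, `E P₂ = 0 = P₂ E`; `F' = P₁ + P₂` is idempotent, commutes with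
`E`, and `rank (F - F') ≤ 2c + c + c`.
HONEST FRAMING: elementary linear algebra; P ≠ NP is not moved; F-N2 is a FRONTIER formal rung.
-/

set_option linter.dupNamespace false -- `Summit.PneNP.PneNP.…`: summit = sub-problem name (D-0017)

namespace Summit.PneNP.PneNP.Theorems.CnfIdealGenLengthRankDefectRepresentationsPairStability

open Filter
open Literature.Computability.Complexity
open Literature.Computability.MetaComplexity
open Literature.Computability.MetaComplexity.NCIPS
open Summit.PneNP.PneNP.Theorems.CnfIdealGenLength

section Fitting

variable {K : Type} [Field K] {d : ℕ}

/-- **Cheap Fitting lemma, structured form.** Every square matrix `A` is within rank `rank (A·A - A)` of an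
idempotent `P` with `im P ⊆ im A` (`P = A R`) and `ker A ⊆ ker P`. [folklore] -/
theorem exists_idempotent_near_struct (A : Matrix (Fin d) (Fin d) K) :
    ∃ P : Matrix (Fin d) (Fin d) K, P * P = P ∧ (A - P).rank ≤ (A * A - A).rank ∧
      (∃ R : Matrix (Fin d) (Fin d) K, P = A * R) ∧ ∀ x : Fin d → K, A.mulVec x = 0 → P.mulVec x = 0 := by
  classical
  let a : (Fin d → K) →ₗ[K] (Fin d → K) := Matrix.toLin' A
  let nn : (Fin d → K) →ₗ[K] (Fin d → K) := Matrix.toLin' (A * A - A)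
  let W : Submodule K (Fin d → K) := LinearMap.ker nn
  have hnn : nn = a * a - a := by
    simp only [nn, a, map_sub, Matrix.toLin'_mul]; rfl
  have hcomm : a * nn = nn * a := by
    rw [hnn, mul_sub, sub_mul, mul_assoc]
  have hW : ∀ w ∈ W, a w ∈ W := by
    intro w hw
    rw [LinearMap.mem_ker] at hw ⊢
    have : nn (a w) = a (nn w) := by
      show (nn * a) w = (a * nn) w
      rw [hcomm]
    rw [this, hw, map_zero]
  have hid : ∀ w ∈ W, a (a w) = a w := by
    intro w hw
    have h0 : nn w = 0 := LinearMap.mem_ker.mp hw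
    rw [hnn] at h0
    simpa [sub_eq_zero] using h0
  have hkerW : ∀ x, a x = 0 → x ∈ W := by
    intro x hx
    rw [LinearMap.mem_ker, hnn]
    simp [hx]
  obtain ⟨W', hWW'⟩ := W.exists_isCompl
  let π : (Fin d → K) →ₗ[K] (Fin d → K) := W.projection W' hWW'
  have hπW : ∀ x, π x ∈ W := fun x => Submodule.projection_apply_mem hWW' x
  have hπid : ∀ w ∈ W, π w = w := fun w hw => Submodule.projection_apply_of_mem_left hWW' hw
  refine ⟨LinearMap.toMatrix' (a ∘ₗ π), ?_, ?_, ?_, ?_⟩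
  · rw [← LinearMap.toMatrix'_mul]
    congr 1
    apply LinearMap.ext
    intro x
    show a (π (a (π x))) = a (π x)
    rw [hπid _ (hW _ (hπW x)), hid _ (hπW x)]
  · have hidπ : LinearMap.id - π = W'.projection W hWW'.symm := by
      rw [sub_eq_iff_eq_add, add_comm]; exact (Submodule.projection_add_projection_eq_id hWW').symm
    have hAE : A - LinearMap.toMatrix' (a ∘ₗ π) = LinearMap.toMatrix' (a ∘ₗ W'.projection W hWW'.symm) := by
      rw [← hidπ, LinearMap.comp_sub, LinearMap.comp_id, map_sub, LinearMap.toMatrix'_toLin']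
    rw [hAE]
    have hrank : ∀ g : (Fin d → K) →ₗ[K] (Fin d → K),
        (LinearMap.toMatrix' g).rank = Module.finrank K (LinearMap.range g) := by
      intro g
      show Module.finrank K (LinearMap.range (Matrix.mulVecLin (LinearMap.toMatrix' g))) = _
      rw [show Matrix.mulVecLin (LinearMap.toMatrix' g) = g from Matrix.toLin'_toMatrix' g]
    have hrk : (A * A - A).rank = Module.finrank K (LinearMap.range nn) := rfl
    rw [hrank, hrk]
    have hW' : Module.finrank K W' = Module.finrank K (LinearMap.range nn) := by
      have h1 := LinearMap.finrank_range_add_finrank_ker nn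
      have h2 := Submodule.finrank_add_eq_of_isCompl hWW'
      have h3 : Module.finrank K W = Module.finrank K (LinearMap.ker nn) := rfl
      omega
    rw [← hW', LinearMap.range_comp]
    refine (Submodule.finrank_map_le _ _).trans ?_
    rw [Submodule.range_projection]
  · refine ⟨LinearMap.toMatrix' π, ?_⟩
    rw [LinearMap.toMatrix'_comp, LinearMap.toMatrix'_toLin']
  · intro x hx
    have hx' : a x = 0 := by simpa [a, Matrix.toLin'_apply] using hx
    have hxW : x ∈ W := hkerW x hx'
    rw [← Matrix.toLin'_apply, Matrix.toLin'_toMatrix']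
    show a (π x) = 0
    rw [hπid x hxW, hx']

end Fitting

/-! ### Pair stability -/

/-- STUB N2 `stub_pairStability` of the line `phantom-kernel` (registered signature, verbatim): two idempotent
matrices are within total rank `4 · rank [E, F]` of a commuting idempotent pair. [folklore] -/
theorem stub_pairStability :
    ∃ C : ℕ, ∀ (K : Type) [Field K] (d : ℕ) (E F : Matrix (Fin d) (Fin d) K), E * E = E → F * F = F →
      ∃ E' F' : Matrix (Fin d) (Fin d) K, E' * E' = E' ∧ F' * F' = F' ∧ E' * F' = F' * E' ∧
        (E - E').rank + (F - F').rank ≤ C * (E * F - F * E).rank := by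
  refine ⟨4, ?_⟩
  intro K _ d E F hE hF
  -- collapsing rewrites
  have hEE : ∀ X : Matrix (Fin d) (Fin d) K, E * (E * X) = E * X := fun X => by rw [← Matrix.mul_assoc, hE]
  have hFF : ∀ X : Matrix (Fin d) (Fin d) K, F * (F * X) = F * X := fun X => by rw [← Matrix.mul_assoc, hF]
  -- the two compressions of `F` to the commutant of `E`
  set A₁ : Matrix (Fin d) (Fin d) K := E * F * E with hA₁
  set A₂ : Matrix (Fin d) (Fin d) K := (1 - E) * F * (1 - E) with hA₂
  set c : ℕ := (E * F - F * E).rank with hc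
  -- (I1) `F - (A₁ + A₂) = E [E,F] - [E,F] E`
  have hI1 : F - (A₁ + A₂) = E * (E * F - F * E) - (E * F - F * E) * E := by
    simp only [hA₁, hA₂, mul_sub, sub_mul, Matrix.mul_one, Matrix.one_mul, Matrix.mul_assoc, hE, hEE]
    abel
  -- (I2) `A₁² - A₁ = -(E [E,F]) (F E)`
  have hI2 : A₁ * A₁ - A₁ = -(E * (E * F - F * E) * (F * E)) := by
    simp only [hA₁, mul_sub, sub_mul, Matrix.mul_assoc, hEE, hFF, neg_sub]
  -- (I3) `A₂² - A₂ = ([E,F] E) (F (1 - E))`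
  have hI3 : A₂ * A₂ - A₂ = (E * F - F * E) * E * (F * (1 - E)) := by
    simp only [hA₂, mul_sub, sub_mul, Matrix.mul_one, Matrix.one_mul, Matrix.mul_assoc, hE, hEE, hF, hFF]
    abel
  have hr1 : (F - (A₁ + A₂)).rank ≤ c + c := by
    rw [hI1, sub_eq_add_neg]
    refine (Literature.Computability.AlgebraicComplexity.rank_add_le _ _).trans (Nat.add_le_add ?_ ?_)
    · exact Matrix.rank_mul_le_right _ _
    · rw [rank_neg_eq]; exact Matrix.rank_mul_le_left _ _
  have hr2 : (A₁ * A₁ - A₁).rank ≤ c := by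
    rw [hI2, rank_neg_eq]
    exact (Matrix.rank_mul_le_left _ _).trans (Matrix.rank_mul_le_right _ _)
  have hr3 : (A₂ * A₂ - A₂).rank ≤ c := by
    rw [hI3]
    exact (Matrix.rank_mul_le_left _ _).trans (Matrix.rank_mul_le_left _ _)
  -- `E A₁ = A₁ = A₁ E`, `A₁ (1 - E) = 0`; `E A₂ = 0 = A₂ E`
  have hEA₁ : E * A₁ = A₁ := by simp only [hA₁, Matrix.mul_assoc, hEE]
  have hA₁E' : A₁ * (1 - E) = 0 := by
    simp only [hA₁, mul_sub, Matrix.mul_one, Matrix.mul_assoc, hE, sub_self]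
  have hEA₂ : E * A₂ = 0 := by
    simp only [hA₂, mul_sub, sub_mul, Matrix.mul_one, Matrix.one_mul, Matrix.mul_assoc, hEE]
    abel
  have hA₂E : A₂ * E = 0 := by
    simp only [hA₂, mul_sub, sub_mul, Matrix.mul_one, Matrix.one_mul, Matrix.mul_assoc, hE]
    abel
  -- structured Fitting on both compressions
  obtain ⟨P₁, hP₁, hP₁r, ⟨R₁, hR₁⟩, hker₁⟩ := exists_idempotent_near_struct A₁
  obtain ⟨P₂, hP₂, hP₂r, ⟨R₂, hR₂⟩, hker₂⟩ := exists_idempotent_near_struct A₂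
  have hEP₁ : E * P₁ = P₁ := by rw [hR₁, ← Matrix.mul_assoc, hEA₁]
  have hEP₂ : E * P₂ = 0 := by rw [hR₂, ← Matrix.mul_assoc, hEA₂, Matrix.zero_mul]
  -- `P (…) = 0` from the kernel inclusions, via `mulVec`
  have hmat_eq_zero : ∀ P Y : Matrix (Fin d) (Fin d) K, (∀ y, P.mulVec (Y.mulVec y) = 0) → P * Y = 0 := by
    intro P Y h
    apply Matrix.toLin'.injective
    rw [map_zero]
    apply LinearMap.ext
    intro y
    rw [Matrix.toLin'_apply, ← Matrix.mulVec_mulVec, LinearMap.zero_apply]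
    exact h y
  have hP₁E' : P₁ * (1 - E) = 0 := hmat_eq_zero P₁ (1 - E) fun y => hker₁ _ (by
    rw [Matrix.mulVec_mulVec, hA₁E', Matrix.zero_mulVec])
  have hP₁E : P₁ * E = P₁ := by
    have := hP₁E'
    rw [mul_sub, Matrix.mul_one, sub_eq_zero] at this
    exact this.symm
  have hP₂E : P₂ * E = 0 := hmat_eq_zero P₂ E fun y => hker₂ _ (by
    rw [Matrix.mulVec_mulVec, hA₂E, Matrix.zero_mulVec])
  -- the commuting idempotent `F' = P₁ + P₂`
  refine ⟨E, P₁ + P₂, hE, ?_, ?_, ?_⟩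
  · have h12 : P₁ * P₂ = 0 := by rw [← hP₁E, Matrix.mul_assoc, hEP₂, Matrix.mul_zero]
    have h21 : P₂ * P₁ = 0 := by rw [← hEP₁, ← Matrix.mul_assoc, hP₂E, Matrix.zero_mul]
    rw [add_mul, mul_add, mul_add, hP₁, hP₂, h12, h21, add_zero, zero_add]
  · rw [mul_add, add_mul, hEP₁, hEP₂, hP₁E, hP₂E]
  · rw [sub_self, Matrix.rank_zero, zero_add]
    have hsplit : F - (P₁ + P₂) = (F - (A₁ + A₂)) + ((A₁ - P₁) + (A₂ - P₂)) := by abel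
    rw [hsplit]
    calc _ ≤ (F - (A₁ + A₂)).rank + ((A₁ - P₁) + (A₂ - P₂)).rank :=
          Literature.Computability.AlgebraicComplexity.rank_add_le _ _
      _ ≤ (c + c) + (c + c) := Nat.add_le_add hr1
          ((Literature.Computability.AlgebraicComplexity.rank_add_le _ _).trans
            (Nat.add_le_add (hP₁r.trans hr2) (hP₂r.trans hr3)))
      _ = 4 * c := by ring

end Summit.PneNP.PneNP.Theorems.CnfIdealGenLengthRankDefectRepresentationsPairStability
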